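import Mathlib
import Literature.Topology.FourManifolds.SimplifiedBrokenLefschetzFibration
import Literature.Topology.FourManifolds.HomotopyS4CompactProofs
import Literature.Topology.FourManifolds.SphereSimplyConnected
import Literature.Topology.FourManifolds.SmoothOrientationProofs
import HarnessLib

/-!
# SimplifiedBrokenLefschetzExistence

Topic `Literature/Topology/FourManifolds`. Named literature fact(s) relocated by the gate from `Summits/SmoothPoincare4/SmoothPoincare4/Theorems/SblfDescentSblfExists.lean`
(accept-time relocation of `[cite]`d propositions written inline in a Summits proposal; human ruling 2026-08-15).
Sources: BaykurSaeki2017.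

* `Literature.Topology.FourManifolds.exists_isSimplifiedBrokenLefschetzFibration`
-/

namespace Literature.Topology.FourManifolds

open scoped Manifold ContDiff Topology ContinuousMap
open Literature.Topology.FourManifolds

/-- NAMED FACT — **existence of simplified broken Lefschetz fibrations with non-empty round
locus** (Baykur–Saeki, *Simplifying indefinite fibrations on 4-manifolds*, arXiv:1705.11169,
Thm. 6.1: *"Let `X` be a closed connected oriented 4-manifold and `Z` be a (non-empty)
null-homologous closed oriented 1-dimensional submanifold of `X` […]. Then, there exists a
fiber-connected, directed broken Lefschetz fibration with embedded round image, whose round locus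
`Z_f` matches `Z`"*, and Cor. 6.2: *"any closed oriented connected 4-manifold `X` admits a
simplified broken Lefschetz fibration"* — proof: take `Z` a null-homotopic circle; "simplified"
(ibid. §2.1 p. 7 and Rem. 6.3) = fiber-connected, embedded round image, connected round locus,
all Lefschetz singularities on the higher side, with the standing genericity conventions of §2.1:
at most one Lefschetz point on any fibre and Lefschetz values off the round image; the regular
fibres over the two sides of the round image are closed connected orientable surfaces of genera
`g` and `g - 1`.  Earlier existence results: Baykur 2008 (arXiv:0801.3139), Lekili,
Akbulut–Karakurt for broken Lefschetz fibrations; Williams 2010 for simplified ones).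
LEAN READING, in the tree's vocabulary (`IsSimplifiedBrokenLefschetzFibration`: smooth onto
`f : M → S²`, positive Lefschetz points at the finite set `L`, indefinite fold charts at the other
critical points, round locus non-empty and connected, `f` injective on the critical set, regular
fibres connected of genus `h + 1` or `h` read as `H₁ ≅ ℤ^{2n}`, both occurring, Lefschetz values
on the genus-`h + 1` side): for every Hausdorff, second countable, compact, connected,
boundaryless `C^∞` 4-manifold `M : Type` and every smooth orientation `o` of `M` there are
`h : ℕ`, `f : M → S²` and a finite `L ⊆ M` with `IsSimplifiedBrokenLefschetzFibration o f L h`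
(the genus of the fibration is `g = h + 1 ≥ 1`).  Every clause is a consequence of the printed
statement, so this is a faithful weakening; users take
`(hX : exists_isSimplifiedBrokenLefschetzFibration)`, nothing is asserted.
TODO(general form): Baykur–Saeki prove more — the round locus can be any prescribed non-empty
null-homologous `Z` with prescribed admissible twisting data, `f` is reached from any generic
map to `S²` by an explicit algorithm of always-realizable base-diagram moves, and by flip-and-slip
every higher genus also occurs.
[cite: BaykurSaeki2017, Thm. 6.1 and Cor. 6.2] [file Topology/FourManifolds/SimplifiedBrokenLefschetzExistence] -/
def exists_isSimplifiedBrokenLefschetzFibration : Prop :=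
  ∀ (M : Type) [TopologicalSpace M] [T2Space M] [SecondCountableTopology M] [CompactSpace M]
    [ConnectedSpace M] [ChartedSpace (EuclideanSpace ℝ (Fin 4)) M] [IsManifold (𝓡 4) ∞ M]
    (o : SmoothOrientation (𝓡 4) M),
    ∃ (h : ℕ) (f : M → Metric.sphere (0 : EuclideanSpace ℝ (Fin 3)) 1) (L : Finset M),
      IsSimplifiedBrokenLefschetzFibration o f L h

/-! ### The item, modulo the fact -/

end Literature.Topology.FourManifolds

/-! ## Relocated from `Summits/SmoothPoincare4/SmoothPoincare4/Theorems/StepGE3/Negative/OfSmoothPoincare4.lean` (gate, accept-time relocation of cited facts) — Baykur2012 -/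

namespace Literature.Topology.FourManifolds

open scoped Manifold ContDiff Topology ContinuousMap

/-- NAMED FACT — **`S⁴` carries simplified broken Lefschetz fibrations with non-empty round locus
of every genus** (Baykur, *Broken Lefschetz fibrations and smooth structures on 4-manifolds*, Geom.
Topol. Monogr. 18 (2012), arXiv:1205.5439).  Thm. 18, verbatim: *"The 4-manifolds `S⁴`,
`#r(S² × S²)` for `r ≥ 2`, `a CP² # b CP²bar` for `a ≥ 0, b ≥ 1` except for `a = b = 1`, and `K3`, all
have broken genus one."* (proof there: *"We immediately see that the broken genera of `S⁴`, `CP²bar`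
(see Figure (trivialgenusoneSBLFs)), and `K3` are one"* — the genus-1 SBLF of `S⁴` with one round
circle and no Lefschetz point of Auroux–Donaldson–Katzarkov 2005, §8.2 Ex. 1; Hayano 2011,
Rem. 4.3); Lemma 12, verbatim: *"If `(X, α)` admits a genus `g` SPWF, then it admits a genus `g`
SBLF. If it admits a genus `g` SBLF, then it admits a genus `g+1` SPWF."* (proof: perturb the
Lefschetz points to cusped circles, inverse-merge them into one, flip-and-slip, merge into ONE round
circle, then unsink the cusps into Lefschetz points on the higher side); hence, by induction on `g`,
`S⁴` admits a genus-`g` SBLF with non-empty connected round locus for every `g ≥ 1`, "simplified" in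
the sense of ibid. §2 (*"the round image is connected […] and the round image is embedded, […] all
the fibers are connected and all the Lefschetz singularities lie over the 2-disk component of
`S² ∖ f(Z)` over which fibers have higher genera"*), and the same holds for every `X'` diffeomorphic
to `S⁴` (ibid. §2, verbatim: *"Let `ψ : X' → X` be a diffeomorphism. If `f : X → S²` is an SBLF with a
regular higher side fiber `F`, then `F' = ψ⁻¹(F)` is a regular higher side fiber of the SBLF
`f' = f ∘ ψ`"*).  LEAN READING, in the tree's vocabulary
(`Literature.Topology.FourManifolds.IsSimplifiedBrokenLefschetzFibration o f L h`: `f : M → S²` smooth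
onto, positive Lefschetz set `L`, indefinite fold charts elsewhere on the critical set, round locus
non-empty and connected, `f` injective on the critical set, regular fibres connected of genus `h + 1`
or `h` read as `H₁ ≅ ℤ^{2n}`, both occurring, Lefschetz values on the genus-`h + 1` side): for every
Hausdorff second-countable `C^∞` 4-manifold `M : Type` charted on `ℝ⁴` and DIFFEOMORPHIC to the unit
sphere `S⁴ ⊆ ℝ⁵`, and every `h : ℕ`, there are `o`, `f`, `L` with
`IsSimplifiedBrokenLefschetzFibration o f L h` (genus `h + 1`).  Users take
`(H : sblf_of_every_genus_of_diffeomorph_sphere_four)`; nothing is asserted.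
[cite: Baykur2012, Thm. 18 and Lemma 12] [file Topology/FourManifolds/SimplifiedBrokenLefschetzExistence] -/
def sblf_of_every_genus_of_diffeomorph_sphere_four : Prop :=
  ∀ (M : Type) [TopologicalSpace M] [T2Space M] [SecondCountableTopology M]
    [ChartedSpace (EuclideanSpace ℝ (Fin 4)) M]
    [IsManifold (modelWithCornersSelf ℝ (EuclideanSpace ℝ (Fin 4))) ((⊤ : ℕ∞) : WithTop ℕ∞) M],
    Nonempty (Diffeomorph (modelWithCornersSelf ℝ (EuclideanSpace ℝ (Fin 4)))
      (modelWithCornersSelf ℝ (EuclideanSpace ℝ (Fin 4))) M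
      (Metric.sphere (0 : EuclideanSpace ℝ (Fin 5)) 1) ((⊤ : ℕ∞) : WithTop ℕ∞)) →
    ∀ h : ℕ, ∃ (o : Literature.Topology.FourManifolds.SmoothOrientation
        (modelWithCornersSelf ℝ (EuclideanSpace ℝ (Fin 4))) M)
      (f : M → Metric.sphere (0 : EuclideanSpace ℝ (Fin 3)) 1) (L : Finset M),
      Literature.Topology.FourManifolds.IsSimplifiedBrokenLefschetzFibration o f L h

end Literature.Topology.FourManifolds
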